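import Summits.CriticalPhenomena.PercolationContinuityZ3.Theorems.PercNearOneGluingNoHeavyQuantTwoBigChain
import HarnessLib

/-!
# QUANT lane R8, Conjecture DIB\* — the two-big certificate, cell `LH/C4`

builds on p205010 (kernel theorem, internal audit signed; external expert review pending)

Support file (`--supports stmt-CriticalPhenomena-4575`), QUANT lane census-1 (gen 17); memo
`run/shared/lean/prim/quant/prim-quant-census-1/TWOBIG-G17.md`.  Theorems only, no definitions, no sorries, standard axioms.
Coordinates `y = 1 − x`, `uᵢ = αᵢφᵢ`, `vᵢ = αᵢ(1 − φᵢ)` (`αᵢ = bᵢ/j`, `φᵢ` = credit rate of big `i`); the three `tbcBlock_*` lemmas are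
LP-found Handelman certificates (products of the cell's defining inequalities, replayed by `linarith`) of a separable budget split
`c₁ + c₂ + c₀ = (1−y)α₁α₂ − P₁P₂`, `cₖ·Dₖ ≤ Bₖ·Nₖ`; `tbcCell_*` combines them into the reduced inequality of the cell
(items in product form).  [this work]; the gluing rows served [cite: KozmaNitzan2024, Conjecture 3 (p. 15)].
-/

namespace Summit.CriticalPhenomena.PercolationContinuityZ3.Theorems

namespace Quant

namespace IndepBlob

set_option maxHeartbeats 1000000 in
set_option maxRecDepth 8192 in
/-- Two-big cell `LH/C4`, block 1: Handelman support (93 products; kit LP; split polynomial rounded to denominators ≤ 16). [this work] -/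
theorem tbcBlock_LH_C4_1 (y u₁ v₁ u₂ v₂ : ℝ) (_hy : 0 ≤ y) (_hhy : 0 ≤ 1 / 2 - y) (_hu1 : 0 ≤ u₁) (_hv1 : 0 ≤ v₁) (_hu2 : 0 ≤ u₂) (_hv2 : 0 ≤ v₂)
    (_ha1 : 0 ≤ 1 - u₁ - v₁) (_hb1 : 0 ≤ u₁ + v₁ - 1 / 2) (_ha2 : 0 ≤ 1 - u₂ - v₂) (_hb2 : 0 ≤ u₂ + v₂ - 1 / 2) (_ht1 : 0 ≤ (1 - y) * v₁ - u₁ * y)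
    (_ht2 : 0 ≤ u₂ * y - (1 - y) * v₂) (_hr2 : 0 ≤ (2 - y) * (1 - u₂ - v₂) - (2 - u₁ - u₂)) :
    (1 / 8 - 9 / 16 * y + 9 / 16 * u₁ + 9 / 16 * v₁ - 1 / 16 * u₂ + 1 / 16 * v₂) * (y * (2 - u₁ - u₂) + (1 + v₁ - u₂) ^ 2)
      ≤ ((u₁ + v₁) * (1 - y) ^ 2 + y * u₁) * (1 + v₁ - u₂) ^ 2 := by
  linarith [
    mul_nonneg (mul_nonneg _hy _hy) _hv1, mul_nonneg (mul_nonneg (mul_nonneg (mul_nonneg _hy _hy) _hv2) _hb2) _hb2,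
    mul_nonneg (mul_nonneg (mul_nonneg (mul_nonneg _hy _hy) _ha1) _ha2) _ha2, mul_nonneg (mul_nonneg (mul_nonneg _hy _hhy) _hv2) _hr2,
    mul_nonneg (mul_nonneg (mul_nonneg _hy _hhy) _hb2) _hr2, mul_nonneg (mul_nonneg _hy _hhy) _hr2,
    mul_nonneg (mul_nonneg (mul_nonneg _hy _hv1) _hv1) _hu2, mul_nonneg (mul_nonneg (mul_nonneg _hy _hv1) _hv1) _ha1,
    mul_nonneg (mul_nonneg (mul_nonneg _hy _hv1) _hv1) _hb2, mul_nonneg (mul_nonneg (mul_nonneg _hy _hv1) _hu2) _hv2,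
    mul_nonneg (mul_nonneg (mul_nonneg _hy _hv1) _hu2) _ht1, mul_nonneg (mul_nonneg (mul_nonneg _hy _hv1) _hv2) _ht2,
    mul_nonneg (mul_nonneg (mul_nonneg _hy _hv1) _ha1) _ha2, mul_nonneg (mul_nonneg (mul_nonneg _hy _hv1) _ha2) _hb2,
    mul_nonneg (mul_nonneg (mul_nonneg _hy _hv1) _ha2) _ht2, mul_nonneg (mul_nonneg _hy _hv1) _ht2,
    mul_nonneg (mul_nonneg (mul_nonneg _hy _hu2) _hv2) _hb1, mul_nonneg (mul_nonneg (mul_nonneg _hy _hu2) _hv2) _ht1,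
    mul_nonneg (mul_nonneg (mul_nonneg _hy _hu2) _ha2) _ht1, mul_nonneg (mul_nonneg _hy _hu2) _hr2,
    mul_nonneg (mul_nonneg (mul_nonneg _hy _ha1) _ha1) _ha1, mul_nonneg (mul_nonneg (mul_nonneg _hy _ha1) _ha2) _ha2,
    mul_nonneg (mul_nonneg (mul_nonneg (mul_nonneg _hy _ha1) _ha2) _ha2) _ha2,
    mul_nonneg (mul_nonneg (mul_nonneg (mul_nonneg _hy _ha1) _hb2) _hb2) _hb2, mul_nonneg (mul_nonneg _hy _hb1) _hr2,
    mul_nonneg (mul_nonneg (mul_nonneg _hy _ha2) _ha2) _ht2, mul_nonneg (mul_nonneg (mul_nonneg _hy _ha2) _hb2) _hr2,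
    mul_nonneg (mul_nonneg _hy _hr2) _hr2, mul_nonneg (mul_nonneg (mul_nonneg (mul_nonneg _hhy _hhy) _hhy) _hv2) _ha2,
    mul_nonneg (mul_nonneg (mul_nonneg (mul_nonneg _hhy _hhy) _hhy) _ha1) _ha2,
    mul_nonneg (mul_nonneg (mul_nonneg (mul_nonneg _hhy _hhy) _hu1) _hv2) _ha1,
    mul_nonneg (mul_nonneg (mul_nonneg (mul_nonneg _hhy _hhy) _hu1) _ha1) _ha1,
    mul_nonneg (mul_nonneg (mul_nonneg (mul_nonneg _hhy _hhy) _hu1) _ha1) _ha2,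
    mul_nonneg (mul_nonneg (mul_nonneg (mul_nonneg _hhy _hhy) _hv1) _ha1) _hb2,
    mul_nonneg (mul_nonneg (mul_nonneg (mul_nonneg _hhy _hhy) _hu2) _hv2) _ha1,
    mul_nonneg (mul_nonneg (mul_nonneg (mul_nonneg _hhy _hhy) _hu2) _ha1) _ha1, mul_nonneg (mul_nonneg (mul_nonneg _hhy _hhy) _hv2) _hv2,
    mul_nonneg (mul_nonneg (mul_nonneg _hhy _hhy) _hv2) _ha2, mul_nonneg (mul_nonneg (mul_nonneg (mul_nonneg _hhy _hhy) _ha1) _ha2) _hb2,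
    mul_nonneg (mul_nonneg (mul_nonneg _hhy _hhy) _ha2) _ht1, mul_nonneg (mul_nonneg (mul_nonneg _hhy _hu1) _hv2) _ha2,
    mul_nonneg (mul_nonneg (mul_nonneg _hhy _hu1) _ha1) _ha1, mul_nonneg (mul_nonneg (mul_nonneg _hhy _hu1) _ha1) _ht1,
    mul_nonneg (mul_nonneg (mul_nonneg _hhy _hv1) _hv1) _ht1, mul_nonneg (mul_nonneg (mul_nonneg _hhy _hv1) _hv2) _hb1,
    mul_nonneg (mul_nonneg (mul_nonneg _hhy _hv1) _hv2) _ht1, mul_nonneg (mul_nonneg (mul_nonneg _hhy _hv1) _hv2) _hr2,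
    mul_nonneg (mul_nonneg (mul_nonneg _hhy _hv1) _ha2) _ht1, mul_nonneg (mul_nonneg (mul_nonneg _hhy _hv1) _ha2) _hr2,
    mul_nonneg (mul_nonneg _hhy _hv1) _ht1, mul_nonneg (mul_nonneg (mul_nonneg _hhy _hu2) _hv2) _ha1,
    mul_nonneg (mul_nonneg (mul_nonneg _hhy _hu2) _hv2) _ha2, mul_nonneg (mul_nonneg (mul_nonneg _hhy _hu2) _ha1) _ht1,
    mul_nonneg (mul_nonneg (mul_nonneg _hhy _hv2) _hv2) _ht1, mul_nonneg (mul_nonneg (mul_nonneg _hhy _hv2) _hb1) _ha2,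
    mul_nonneg (mul_nonneg _hhy _hv2) _ha2, mul_nonneg (mul_nonneg (mul_nonneg _hhy _hv2) _ha2) _ht1, mul_nonneg (mul_nonneg _hhy _hv2) _ht1,
    mul_nonneg (mul_nonneg (mul_nonneg _hhy _ha1) _ha1) _hb2, mul_nonneg (mul_nonneg _hhy _ha1) _hr2,
    mul_nonneg (mul_nonneg (mul_nonneg _hhy _hb1) _ha2) _ht1, mul_nonneg (mul_nonneg _hhy _ha2) _ht1, mul_nonneg (mul_nonneg _hhy _ha2) _hr2,
    mul_nonneg (mul_nonneg _hu1 _hv1) _hv2, mul_nonneg (mul_nonneg _hu1 _hv2) _hv2, mul_nonneg (mul_nonneg _hu1 _hv2) _ha2,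
    mul_nonneg (mul_nonneg _hu1 _hv2) _ht1, mul_nonneg (mul_nonneg _hu1 _ha1) _ht1, mul_nonneg (mul_nonneg _hu1 _ha2) _ht1,
    mul_nonneg (mul_nonneg _hv1 _hv1) _hb2, mul_nonneg (mul_nonneg _hv1 _hv1) _hr2, mul_nonneg (mul_nonneg _hv1 _hv2) _hr2,
    mul_nonneg (mul_nonneg _hv1 _hb1) _hr2, mul_nonneg (mul_nonneg _hv1 _ha2) _hr2, mul_nonneg _hv1 _hr2, mul_nonneg (mul_nonneg _hu2 _hv2) _hv2,
    mul_nonneg (mul_nonneg _hu2 _hv2) _ha2, mul_nonneg (mul_nonneg _hu2 _ht2) _hr2, mul_nonneg (mul_nonneg _hv2 _ha2) _hb2,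
    mul_nonneg (mul_nonneg _hv2 _ha2) _hr2, mul_nonneg _hv2 _ht1, mul_nonneg (mul_nonneg _hv2 _ht1) _ht1, mul_nonneg (mul_nonneg _hv2 _ht1) _hr2,
    mul_nonneg (mul_nonneg _hv2 _ht2) _ht2, mul_nonneg _hv2 _hr2, mul_nonneg (mul_nonneg _ha1 _ha1) _ha1, mul_nonneg (mul_nonneg _ha1 _ha1) _hb2,
    mul_nonneg (mul_nonneg _ha1 _hb1) _ht1, mul_nonneg (mul_nonneg _ha1 _hr2) _hr2, mul_nonneg (mul_nonneg _hb1 _ha2) _hr2,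
    mul_nonneg (mul_nonneg _ha2 _hb2) _ht1, mul_nonneg (mul_nonneg _ha2 _hb2) _hr2, mul_nonneg (mul_nonneg _ha2 _ht1) _hr2]

set_option maxHeartbeats 1000000 in
set_option maxRecDepth 8192 in
/-- Two-big cell `LH/C4`, block 2: Handelman support (69 products; kit LP; split polynomial rounded to denominators ≤ 16). [this work] -/
theorem tbcBlock_LH_C4_2 (y u₁ v₁ u₂ v₂ : ℝ) (_hy : 0 ≤ y) (_hhy : 0 ≤ 1 / 2 - y) (_hu1 : 0 ≤ u₁) (_hv1 : 0 ≤ v₁) (_hu2 : 0 ≤ u₂) (_hv2 : 0 ≤ v₂)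
    (_ha1 : 0 ≤ 1 - u₁ - v₁) (_hb1 : 0 ≤ u₁ + v₁ - 1 / 2) (_ha2 : 0 ≤ 1 - u₂ - v₂) (_hb2 : 0 ≤ u₂ + v₂ - 1 / 2) (_ht1 : 0 ≤ (1 - y) * v₁ - u₁ * y)
    (_ht2 : 0 ≤ u₂ * y - (1 - y) * v₂) (_hr2 : 0 ≤ (2 - y) * (1 - u₂ - v₂) - (2 - u₁ - u₂)) :
    (-1 / 8 - 3 / 4 * y + 1 / 16 * u₁ + 1 / 2 * v₁ + 5 / 8 * u₂ + 7 / 16 * v₂) * ((2 - u₁ - u₂) - (1 - y) * (1 - u₂ - v₂))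
      ≤ (((u₁ + v₁) * (2 - y) - u₁) * u₂) * ((1 - y) * (1 + v₂ - u₁)) := by
  linarith [
    mul_nonneg _hy _hy, mul_nonneg (mul_nonneg _hy _hy) _ha2, mul_nonneg (mul_nonneg (mul_nonneg _hy _hhy) _hv2) _ha1,
    mul_nonneg (mul_nonneg (mul_nonneg (mul_nonneg _hy _hhy) _hv2) _ha1) _ha2, mul_nonneg (mul_nonneg (mul_nonneg _hy _hu1) _hu2) _hb2,
    mul_nonneg (mul_nonneg _hy _hv1) _ha1, mul_nonneg (mul_nonneg (mul_nonneg _hy _hu2) _hb2) _hb2, mul_nonneg (mul_nonneg _hy _hu2) _hr2,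
    mul_nonneg (mul_nonneg _hy _hv2) _ha1, mul_nonneg (mul_nonneg _hy _hv2) _ha2, mul_nonneg (mul_nonneg (mul_nonneg _hy _hv2) _ha2) _ha2,
    mul_nonneg _hy _ha1, mul_nonneg (mul_nonneg _hy _ha1) _ha1, mul_nonneg (mul_nonneg _hy _ha1) _ha2, mul_nonneg (mul_nonneg _hy _hb1) _hr2,
    mul_nonneg (mul_nonneg _hy _ha2) _ha2, mul_nonneg (mul_nonneg (mul_nonneg _hy _ha2) _ha2) _ha2, mul_nonneg (mul_nonneg _hy _hb2) _hr2,
    mul_nonneg (mul_nonneg (mul_nonneg (mul_nonneg _hhy _hhy) _hu2) _hu2) _ha1, mul_nonneg (mul_nonneg (mul_nonneg _hhy _hhy) _hu2) _hv2,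
    mul_nonneg (mul_nonneg (mul_nonneg (mul_nonneg _hhy _hhy) _hu2) _ha1) _hb1, mul_nonneg (mul_nonneg (mul_nonneg _hhy _hhy) _hv2) _hb2,
    mul_nonneg (mul_nonneg (mul_nonneg _hhy _hhy) _ha1) _hb1, mul_nonneg (mul_nonneg (mul_nonneg _hhy _hu1) _ha1) _hb2,
    mul_nonneg (mul_nonneg (mul_nonneg _hhy _hv1) _hu2) _hv2, mul_nonneg (mul_nonneg (mul_nonneg _hhy _hv1) _hu2) _ht1,
    mul_nonneg (mul_nonneg (mul_nonneg _hhy _hu2) _hu2) _ha1, mul_nonneg (mul_nonneg _hhy _hu2) _hv2,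
    mul_nonneg (mul_nonneg (mul_nonneg _hhy _hu2) _hv2) _hb1, mul_nonneg (mul_nonneg (mul_nonneg _hhy _hu2) _hv2) _ht1,
    mul_nonneg (mul_nonneg (mul_nonneg _hhy _hu2) _ha1) _hb1, mul_nonneg (mul_nonneg (mul_nonneg _hhy _hu2) _ha1) _hb2,
    mul_nonneg (mul_nonneg (mul_nonneg _hhy _hu2) _ha1) _ht1, mul_nonneg (mul_nonneg (mul_nonneg _hhy _hu2) _ha1) _hr2,
    mul_nonneg (mul_nonneg (mul_nonneg _hhy _hu2) _ha2) _ht1, mul_nonneg (mul_nonneg _hhy _hv2) _hr2,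
    mul_nonneg (mul_nonneg (mul_nonneg _hhy _ha1) _ha1) _hr2, mul_nonneg (mul_nonneg (mul_nonneg _hhy _ha1) _hb1) _hb2,
    mul_nonneg (mul_nonneg (mul_nonneg _hhy _ha2) _hb2) _ht1, mul_nonneg (mul_nonneg _hu1 _hu2) _hv2, mul_nonneg (mul_nonneg _hu1 _hv2) _hb2,
    mul_nonneg (mul_nonneg _hu1 _ha1) _hb2, mul_nonneg (mul_nonneg _hu1 _ha1) _ht1, mul_nonneg (mul_nonneg _hv1 _hu2) _ht1,
    mul_nonneg (mul_nonneg _hv1 _hv2) _ht2, mul_nonneg (mul_nonneg _hv1 _hb1) _hr2, mul_nonneg (mul_nonneg _hv1 _hb2) _hb2,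
    mul_nonneg (mul_nonneg _hv1 _hb2) _ht1, mul_nonneg _hv1 _ht2, mul_nonneg (mul_nonneg _hu2 _hv2) _ht1, mul_nonneg (mul_nonneg _hu2 _ha1) _hb1,
    mul_nonneg (mul_nonneg _hu2 _ha1) _hb2, mul_nonneg (mul_nonneg _hu2 _ha1) _hr2, mul_nonneg (mul_nonneg _hu2 _ht1) _ht1, mul_nonneg _hv2 _ha1,
    mul_nonneg (mul_nonneg _hv2 _hb1) _hr2, mul_nonneg (mul_nonneg _hv2 _ht1) _hr2, mul_nonneg _hv2 _ht2, mul_nonneg (mul_nonneg _ha1 _hb1) _hb2,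
    mul_nonneg (mul_nonneg _ha1 _ha2) _ha2, mul_nonneg (mul_nonneg _ha1 _hb2) _hb2, mul_nonneg (mul_nonneg _ha1 _hb2) _hr2,
    mul_nonneg (mul_nonneg _ha1 _hr2) _hr2, mul_nonneg (mul_nonneg _ha2 _ht1) _ht2, mul_nonneg (mul_nonneg _ha2 _ht1) _hr2, mul_nonneg _hb2 _ht1,
    mul_nonneg (mul_nonneg _hb2 _ht1) _ht1, mul_nonneg _ht1 _ht1, mul_nonneg _ht1 _ht2]

set_option maxHeartbeats 1000000 in
set_option maxRecDepth 8192 in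
/-- Two-big cell `LH/C4`, block 0: Handelman support (28 products; kit LP; split polynomial rounded to denominators ≤ 16). [this work] -/
theorem tbcBlock_LH_C4_0 (y u₁ v₁ u₂ v₂ : ℝ) (_hy : 0 ≤ y) (_hhy : 0 ≤ 1 / 2 - y) (_hu1 : 0 ≤ u₁) (_hv1 : 0 ≤ v₁) (_hu2 : 0 ≤ u₂) (_hv2 : 0 ≤ v₂)
    (_ha1 : 0 ≤ 1 - u₁ - v₁) (_hb1 : 0 ≤ u₁ + v₁ - 1 / 2) (_ha2 : 0 ≤ 1 - u₂ - v₂) (_hb2 : 0 ≤ u₂ + v₂ - 1 / 2) (_ht1 : 0 ≤ (1 - y) * v₁ - u₁ * y)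
    (_ht2 : 0 ≤ u₂ * y - (1 - y) * v₂) (_hr2 : 0 ≤ (2 - y) * (1 - u₂ - v₂) - (2 - u₁ - u₂)) :
    7 / 16 * u₁ * v₂ + 7 / 16 * v₁ * v₂ - y * u₁ * v₂ + y * v₁ * u₂ - y * v₁ * v₂ - y ^ 2 * u₁ * u₂ - y ^ 2 * v₁ * u₂ - 1 / 8 * v₂ + 1 / 8 * y * v₂ +
          1 / 16 * u₂ * v₂ - 1 / 16 * v₂ ^ 2 + 1 / 8 * y + 3 / 4 * y ^ 2 - 1 / 16 * y * u₁ - 1 / 2 * y * v₁ - 5 / 8 * y * u₂ ≤ (0 : ℝ) := by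
  linarith [
    mul_nonneg (mul_nonneg (mul_nonneg _hy _hy) _hu1) _hb2, mul_nonneg (mul_nonneg _hy _hy) _hv1, mul_nonneg (mul_nonneg _hy _hy) _hb1,
    mul_nonneg (mul_nonneg (mul_nonneg _hy _hy) _hb1) _hb2, mul_nonneg (mul_nonneg _hy _hy) _hb2, mul_nonneg (mul_nonneg _hy _hhy) _hv2,
    mul_nonneg (mul_nonneg _hy _hhy) _ha1, mul_nonneg (mul_nonneg (mul_nonneg _hy _hhy) _ha1) _ha1,
    mul_nonneg (mul_nonneg (mul_nonneg _hy _hhy) _ha1) _hb2, mul_nonneg (mul_nonneg (mul_nonneg _hy _hu1) _hu1) _hb2,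
    mul_nonneg (mul_nonneg (mul_nonneg _hy _hu1) _ha1) _hb2, mul_nonneg (mul_nonneg (mul_nonneg _hy _hv1) _hv1) _ha2,
    mul_nonneg (mul_nonneg _hy _hv1) _hv2, mul_nonneg (mul_nonneg (mul_nonneg _hy _hv1) _ha1) _ha2, mul_nonneg (mul_nonneg _hy _hv1) _hr2,
    mul_nonneg (mul_nonneg _hy _hu2) _hr2, mul_nonneg (mul_nonneg _hy _hv2) _hb1, mul_nonneg (mul_nonneg _hy _hv2) _ht1,
    mul_nonneg (mul_nonneg (mul_nonneg _hy _ha1) _ha1) _hb2, mul_nonneg (mul_nonneg _hy _ha1) _ht1, mul_nonneg (mul_nonneg _hy _ha1) _hr2,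
    mul_nonneg _hy _hr2, mul_nonneg (mul_nonneg _hhy _hu2) _ht2, mul_nonneg (mul_nonneg _hhy _hv2) _ha1, mul_nonneg _hhy _ht2, mul_nonneg _hu2 _ht2,
    mul_nonneg _hv2 _hv2, _ht2]

set_option maxHeartbeats 1000000 in
/-- **Two-big cell `LH/C4`**: the reduced inequality from the three blocks (items in product form `N ≤ t·D`). [this work] -/
theorem tbcCell_LH_C4 (y u₁ v₁ u₂ v₂ t₁ t₂ t₀ : ℝ) (hy0 : 0 < y) (hhy : y ≤ 1 / 2) (hu1 : 0 ≤ u₁) (hv1 : 0 ≤ v₁) (hu2 : 0 ≤ u₂) (hv2 : 0 ≤ v₂)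
    (ha1 : u₁ + v₁ ≤ 1) (hb1 : 1 / 2 ≤ u₁ + v₁) (ha2 : u₂ + v₂ ≤ 1) (hb2 : 1 / 2 ≤ u₂ + v₂) (ht1 : 0 ≤ (1 - y) * v₁ - u₁ * y)
    (ht2 : 0 ≤ u₂ * y - (1 - y) * v₂) (hr2 : 0 ≤ (2 - y) * (1 - u₂ - v₂) - (2 - u₁ - u₂)) (hct : 0 < (2 - u₁ - u₂))
    (hT1 : (1 + v₁ - u₂) ^ 2 ≤ t₁ * (y * (2 - u₁ - u₂) + (1 + v₁ - u₂) ^ 2))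
    (hT2 : ((1 - y) * (1 + v₂ - u₁)) ≤ t₂ * ((2 - u₁ - u₂) - (1 - y) * (1 - u₂ - v₂))) (hT0 : 0 ≤ t₀) :
    (1 - y) * ((u₁ + v₁) * (u₂ + v₂))
      ≤ ((u₁ + v₁) * (1 - y) ^ 2 + y * u₁) * u₂ + ((u₁ + v₁) * (1 - y) ^ 2 + y * u₁) * v₂ * t₁ + (y * ((u₁ + v₁) * (2 - y) - u₁)) * u₂ * t₂ + (y *
            ((u₁ + v₁) * (2 - y) - u₁)) * v₂ * t₀ := by
  have b1 := tbcBlock_LH_C4_1 y u₁ v₁ u₂ v₂ hy0.le (by linarith) hu1 hv1 hu2 hv2 (by linarith) (by linarith) (by linarith) (by linarith) ht1 ht2 hr2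
  have b2 := tbcBlock_LH_C4_2 y u₁ v₁ u₂ v₂ hy0.le (by linarith) hu1 hv1 hu2 hv2 (by linarith) (by linarith) (by linarith) (by linarith) ht1 ht2 hr2
  have b0 := tbcBlock_LH_C4_0 y u₁ v₁ u₂ v₂ hy0.le (by linarith) hu1 hv1 hu2 hv2 (by linarith) (by linarith) (by linarith) (by linarith) ht1 ht2 hr2
  have hD1 : (0:ℝ) < (y * (2 - u₁ - u₂) + (1 + v₁ - u₂) ^ 2) := by
    have h1 := mul_pos hy0 hct
    have h2 := sq_nonneg (1 + v₁ - u₂)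
    linarith
  have hD2 : (0:ℝ) < ((2 - u₁ - u₂) - (1 - y) * (1 - u₂ - v₂)) := by
    have h1 := mul_pos hy0 hct
    have h2 : (0:ℝ) ≤ (1 - y) * (1 + v₂ - u₁) := mul_nonneg (by linarith) (by linarith)
    linarith
  have hP1 : (0:ℝ) ≤ ((u₁ + v₁) * (1 - y) ^ 2 + y * u₁) := by
    have h1 := mul_nonneg (show (0:ℝ) ≤ u₁ + v₁ by linarith) (sq_nonneg (1 - y))
    have h2 := mul_nonneg hy0.le hu1
    linarith
  have hQt1 : (0:ℝ) ≤ ((u₁ + v₁) * (2 - y) - u₁) := by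
    have h1 := mul_nonneg (show (0:ℝ) ≤ 1 - y by linarith) (show (0:ℝ) ≤ u₁ + v₁ by linarith)
    linarith
  have hQ1 : (0:ℝ) ≤ (y * ((u₁ + v₁) * (2 - y) - u₁)) := mul_nonneg hy0.le hQt1
  have hP2 : (0:ℝ) ≤ u₂ := hu2
  have hQ2 : (0:ℝ) ≤ v₂ := hv2
  have hBF1 : (0:ℝ) ≤ ((u₁ + v₁) * (1 - y) ^ 2 + y * u₁) := hP1
  have k1 : (1 / 8 - 9 / 16 * y + 9 / 16 * u₁ + 9 / 16 * v₁ - 1 / 16 * u₂ + 1 / 16 * v₂) ≤ ((u₁ + v₁) * (1 - y) ^ 2 + y * u₁) * t₁ := tbc_block_le _ _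
        _ _ _ hBF1 hD1 hT1 b1
  have hBF2 : (0:ℝ) ≤ (((u₁ + v₁) * (2 - y) - u₁) * u₂) := mul_nonneg hQt1 hP2
  have k2 : (-1 / 8 - 3 / 4 * y + 1 / 16 * u₁ + 1 / 2 * v₁ + 5 / 8 * u₂ + 7 / 16 * v₂) ≤ (((u₁ + v₁) * (2 - y) - u₁) * u₂) * t₂ := tbc_block_le _ _ _
        _ _ hBF2 hD2 hT2 b2
  have hB0 : (0:ℝ) ≤ ((y * ((u₁ + v₁) * (2 - y) - u₁)) * v₂) := mul_nonneg hQ1 hQ2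
  have k0 : (7 / 16 * u₁ * v₂ + 7 / 16 * v₁ * v₂ - y * u₁ * v₂ + y * v₁ * u₂ - y * v₁ * v₂ - y ^ 2 * u₁ * u₂ - y ^ 2 * v₁ * u₂ - 1 / 8 * v₂ + 1 / 8 *
        y * v₂ + 1 / 16 * u₂ * v₂ - 1 / 16 * v₂ ^ 2 + 1 / 8 * y + 3 / 4 * y ^ 2 - 1 / 16 * y * u₁ - 1 / 2 * y * v₁ - 5 / 8 * y * u₂) ≤ ((y * ((u₁ +
        v₁) * (2 - y) - u₁)) * v₂) * t₀ := b0.trans (mul_nonneg hB0 hT0)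
  have e : (1 / 8 * v₂ - 9 / 16 * y * v₂ + 9 / 16 * u₁ * v₂ + 9 / 16 * v₁ * v₂ - 1 / 16 * u₂ * v₂ + 1 / 16 * v₂ ^ 2) + (-1 / 8 * y - 3 / 4 * y ^ 2 + 1
        / 16 * y * u₁ + 1 / 2 * y * v₁ + 5 / 8 * y * u₂ + 7 / 16 * y * v₂) + (7 / 16 * u₁ * v₂ + 7 / 16 * v₁ * v₂ - y * u₁ * v₂ + y * v₁ * u₂ - y * v₁
        * v₂ - y ^ 2 * u₁ * u₂ - y ^ 2 * v₁ * u₂ - 1 / 8 * v₂ + 1 / 8 * y * v₂ + 1 / 16 * u₂ * v₂ - 1 / 16 * v₂ ^ 2 + 1 / 8 * y + 3 / 4 * y ^ 2 - 1 /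
        16 * y * u₁ - 1 / 2 * y * v₁ - 5 / 8 * y * u₂) = (1 - y) * ((u₁ + v₁) * (u₂ + v₂)) - ((u₁ + v₁) * (1 - y) ^ 2 + y * u₁) * u₂ := by ring
  have k1F := mul_le_mul_of_nonneg_left k1 hv2
  have ec1 : v₂ * (1 / 8 - 9 / 16 * y + 9 / 16 * u₁ + 9 / 16 * v₁ - 1 / 16 * u₂ + 1 / 16 * v₂) = 1 / 8 * v₂ - 9 / 16 * y * v₂ + 9 / 16 * u₁ * v₂ + 9 /
        16 * v₁ * v₂ - 1 / 16 * u₂ * v₂ + 1 / 16 * v₂ ^ 2 := by ring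
  have eb1 : v₂ * (((u₁ + v₁) * (1 - y) ^ 2 + y * u₁) * t₁) = ((u₁ + v₁) * (1 - y) ^ 2 + y * u₁) * v₂ * t₁ := by ring
  have kk1 : (1 / 8 * v₂ - 9 / 16 * y * v₂ + 9 / 16 * u₁ * v₂ + 9 / 16 * v₁ * v₂ - 1 / 16 * u₂ * v₂ + 1 / 16 * v₂ ^ 2) ≤ ((u₁ + v₁) * (1 - y) ^ 2 + y
        * u₁) * v₂ * t₁ := by rw [← ec1, ← eb1]; exact k1F
  have k2F := mul_le_mul_of_nonneg_left k2 hy0.le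
  have ec2 : y * (-1 / 8 - 3 / 4 * y + 1 / 16 * u₁ + 1 / 2 * v₁ + 5 / 8 * u₂ + 7 / 16 * v₂) = -1 / 8 * y - 3 / 4 * y ^ 2 + 1 / 16 * y * u₁ + 1 / 2 * y
        * v₁ + 5 / 8 * y * u₂ + 7 / 16 * y * v₂ := by ring
  have eb2 : y * ((((u₁ + v₁) * (2 - y) - u₁) * u₂) * t₂) = (y * ((u₁ + v₁) * (2 - y) - u₁)) * u₂ * t₂ := by ring
  have kk2 : (-1 / 8 * y - 3 / 4 * y ^ 2 + 1 / 16 * y * u₁ + 1 / 2 * y * v₁ + 5 / 8 * y * u₂ + 7 / 16 * y * v₂) ≤ (y * ((u₁ + v₁) * (2 - y) - u₁)) *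
        u₂ * t₂ := by rw [← ec2, ← eb2]; exact k2F
  have hsum := add_le_add (add_le_add kk1 kk2) k0
  calc (1 - y) * ((u₁ + v₁) * (u₂ + v₂)) = ((u₁ + v₁) * (1 - y) ^ 2 + y * u₁) * u₂ + ((1 / 8 * v₂ - 9 / 16 * y * v₂ + 9 / 16 * u₁ * v₂ + 9 / 16 * v₁ *
        v₂ - 1 / 16 * u₂ * v₂ + 1 / 16 * v₂ ^ 2) + (-1 / 8 * y - 3 / 4 * y ^ 2 + 1 / 16 * y * u₁ + 1 / 2 * y * v₁ + 5 / 8 * y * u₂ + 7 / 16 * y * v₂)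
        + (7 / 16 * u₁ * v₂ + 7 / 16 * v₁ * v₂ - y * u₁ * v₂ + y * v₁ * u₂ - y * v₁ * v₂ - y ^ 2 * u₁ * u₂ - y ^ 2 * v₁ * u₂ - 1 / 8 * v₂ + 1 / 8 * y
        * v₂ + 1 / 16 * u₂ * v₂ - 1 / 16 * v₂ ^ 2 + 1 / 8 * y + 3 / 4 * y ^ 2 - 1 / 16 * y * u₁ - 1 / 2 * y * v₁ - 5 / 8 * y * u₂)) := by rw [e]; ring
    _ ≤ ((u₁ + v₁) * (1 - y) ^ 2 + y * u₁) * u₂ + (((u₁ + v₁) * (1 - y) ^ 2 + y * u₁) * v₂ * t₁ + (y * ((u₁ + v₁) * (2 - y) - u₁)) * u₂ * t₂ + (y *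
          ((u₁ + v₁) * (2 - y) - u₁)) * v₂ * t₀) := add_le_add le_rfl hsum
    _ = _ := by ring

end IndepBlob

end Quant

end Summit.CriticalPhenomena.PercolationContinuityZ3.Theorems
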